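import Summits.HubbardSuperconductivity.HubbardSuperconductivity.Theorems.BirComplexStableXY.Negative.WitnessTable

/-!
# Crux `BirComplexStableXYR` (item `stmt-HubbardSuperconductivity-14845`): load-bearing analysis — coercivity

The restated engine of route BalabanIR (`Theses.BalabanIR.BirComplexStableXYR`, crux 2R, rank 2) asks,
for every window size `r ≥ 2` and constants `B`, `c₀ > 0`, for thresholds `K₀, L₀` such that every finite
Fourier table `c` with (U1) charge neutrality, (N) `Σ c = 0`, (A) `Σ ‖c_n‖ e^{|n|₁} ≤ B`, (C) COERCIVITY
`c₀ ΣΣ (1 − cos(φ_w − φ_w')) ≤ Re F`, (R) time-reflection Hermiticity and (P) inversion evenness gives, at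
every `K ≥ K₀` and all even `L₀ ≤ L ≤ M`, a non-zero partition function `Z` and slice order `≥ 1/2`.

Negative-side lemma of the standing disprover (cdisprove cycle 1; NO definition is introduced — the mutated
statement is spelled out verbatim; nothing here asserts a Theses decl positively):

* `birComplexStableXYR_false_without_coercivity` — **(C) is load-bearing**: the crux with hypothesis (C)
  deleted (all of (U1), (N), (A), (R), (P), evenness and `L ≤ M` kept) is FALSE.  Witness: the free table
  `c = 0` (i.i.d. uniform angles) is in the mutated class for `B = 0` ((R), (P) hold trivially), its
  partition function is `(2π)^{L² M} ≠ 0` (`partZ_zero_table`) and its slice-order numerator is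
  `L² (2π)^{L² M} / L⁴` (`sliceNumerator_zero_table`, orthogonality of characters on the statement's own
  cube), so the slice order is exactly `1/L² ≤ 1/4 < 1/2` at the even side `L = M = 2(L₀+1)`.

So any proof of the crux must use (C) quantitatively (the only hypothesis that sees `K`).  Workfile with the
full attack log: `Cruxes/BirComplexStableXYR/Disproof.lean`.  [folklore]
-/

noncomputable section

namespace Summit.HubbardSuperconductivity.HubbardSuperconductivity.Theorems.BirComplexStableXYR.Negative

open scoped BigOperators ComplexConjugate
open MeasureTheory Literature.Probability.LatticeModels
open Summit.HubbardSuperconductivity.BirComplexStableXYNegative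

/-! ### Free-measure computations (table `c = 0`) -/

/-- With `c = 0` the action vanishes identically. -/
theorem action_zero_table {r : ℕ} (K : ℝ) (L M : ℕ) [NeZero L] [NeZero M] (θ : Λ L M → ℝ) :
    action K (0 : Table r) L M θ = 0 := by
  simp [action, genF]

/-- The cube measure is the product of `L² M` copies of Lebesgue measure on `[0, 2π]`. -/
theorem restrict_cube_eq_pi (L M : ℕ) [NeZero L] [NeZero M] :
    (volume : Measure (Λ L M → ℝ)).restrict (cube L M) =
      Measure.pi (fun _ : Λ L M => (volume : Measure ℝ).restrict (Set.Icc (0:ℝ) (2 * Real.pi))) := by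
  rw [cube, volume_pi, Measure.restrict_pi_pi]

/-- `∫_0^{2π} e^{i n t} dt = 2π·𝟙{n = 0}` for `n ∈ ℤ`. [folklore] -/
theorem integral_cexp_int_mul (n : ℤ) :
    ∫ t, Complex.exp (Complex.I * (((n : ℝ) * t : ℝ) : ℂ))
        ∂((volume : Measure ℝ).restrict (Set.Icc (0:ℝ) (2 * Real.pi))) =
      if n = 0 then ((2 * Real.pi : ℝ) : ℂ) else 0 := by
  rw [integral_Icc_eq_integral_Ioc, ← intervalIntegral.integral_of_le (by positivity : (0:ℝ) ≤ 2 * Real.pi)]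
  split_ifs with hn
  · subst hn
    simp
  · have hc : (Complex.I * (n : ℂ)) ≠ 0 := by simp [Complex.I_ne_zero, hn]
    have key : ∀ t : ℝ, Complex.exp (Complex.I * (((n : ℝ) * t : ℝ) : ℂ)) =
        Complex.exp ((Complex.I * (n : ℂ)) * t) := by
      intro t; congr 1; push_cast; ring
    simp_rw [key]
    rw [integral_exp_mul_complex hc]
    have h2 : Complex.exp (Complex.I * (n : ℂ) * (2 * (Real.pi : ℂ))) = 1 := by
      have : Complex.I * (n : ℂ) * (2 * (Real.pi : ℂ)) = (n : ℂ) * (2 * Real.pi * Complex.I) := by ring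
      rw [this]
      exact Complex.exp_int_mul_two_pi_mul_I n
    push_cast
    simp [h2]

/-- Orthogonality of characters on the cube `[0,2π]^Λ`:
`∫ e^{i w·θ} dθ = (2π)^{|Λ|}·𝟙{w = 0}` for `w ∈ ℤ^Λ`. [folklore] -/
theorem integral_cube_cexp_phase (L M : ℕ) [NeZero L] [NeZero M] (w : Λ L M → ℤ) :
    ∫ θ, Complex.exp (Complex.I * ((∑ s, (w s : ℝ) * θ s : ℝ) : ℂ)) ∂(volume.restrict (cube L M)) =
      if w = 0 then ((2 * Real.pi : ℝ) : ℂ) ^ Fintype.card (Λ L M) else 0 := by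
  rw [restrict_cube_eq_pi]
  set f : Λ L M → ℝ → ℂ := fun s t => Complex.exp (Complex.I * ((((w s : ℝ) * t : ℝ)) : ℂ)) with hf
  have key : ∀ θ : Λ L M → ℝ,
      Complex.exp (Complex.I * ((∑ s, (w s : ℝ) * θ s : ℝ) : ℂ)) = ∏ s, f s (θ s) := by
    intro θ
    simp only [hf, ← Complex.exp_sum]
    congr 1
    push_cast
    rw [Finset.mul_sum]
  simp_rw [key]
  rw [integral_fintype_prod_eq_prod (𝕜 := ℂ) f]
  have hj : ∀ s, ∫ t, f s t ∂((volume : Measure ℝ).restrict (Set.Icc (0:ℝ) (2 * Real.pi))) =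
      if w s = 0 then ((2 * Real.pi : ℝ) : ℂ) else 0 := fun s => integral_cexp_int_mul (w s)
  simp_rw [hj]
  split_ifs with hw
  · subst hw
    simp
  · obtain ⟨s, hs⟩ : ∃ s, w s ≠ 0 := by
      by_contra h
      push Not at h
      exact hw (funext h)
    exact Finset.prod_eq_zero (Finset.mem_univ s) (if_neg hs)

/-- The free partition function: `Z = (2π)^{|Λ|}` at `c = 0` (any window size `r`, any `K`). -/
theorem partZ_zero_table {r : ℕ} (K : ℝ) (L M : ℕ) [NeZero L] [NeZero M] :
    partZ K (0 : Table r) L M = ((2 * Real.pi : ℝ) : ℂ) ^ Fintype.card (Λ L M) := by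
  have h := integral_cube_cexp_phase L M 0
  rw [if_pos rfl] at h
  unfold partZ
  rw [← h]
  congr 1
  funext θ
  simp [action_zero_table]

/-- the frequency vector `δ_{(x,0)} − δ_{(y,0)}` pairs with `θ` to `θ(x,0) − θ(y,0)`. -/
theorem sum_frq_mul (L M : ℕ) [NeZero L] [NeZero M] (x y : TorusSite 2 L) (θ : Λ L M → ℝ) :
    (∑ s, (((Pi.single (x, (0 : ZMod M)) 1 - Pi.single (y, (0 : ZMod M)) 1 : Λ L M → ℤ) s : ℤ) : ℝ) * θ s)
      = θ (x, 0) - θ (y, 0) := by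
  simp [Pi.single_apply, sub_mul, Finset.sum_sub_distrib]

/-- the frequency vector `δ_{(x,0)} − δ_{(y,0)}` vanishes iff `x = y`. -/
theorem frq_eq_zero_iff (L M : ℕ) [NeZero L] [NeZero M] {x y : TorusSite 2 L} :
    (Pi.single (x, (0 : ZMod M)) 1 - Pi.single (y, (0 : ZMod M)) 1 : Λ L M → ℤ) = 0 ↔ x = y := by
  constructor
  · intro h
    by_contra hxy
    have hne : (x, (0 : ZMod M)) ≠ (y, 0) := fun e => hxy (Prod.mk.inj e).1
    have := congrFun h (x, 0)
    simp [Ne.symm hne] at this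
  · rintro rfl
    simp

/-- pointwise: `|Σ_x e^{iθ_x}|² = Σ_{x,y} e^{i(θ_x − θ_y)}` written with integer frequency vectors. -/
theorem normSq_sliceSum_eq (L M : ℕ) [NeZero L] [NeZero M] (θ : Λ L M → ℝ) :
    ((‖∑ x : TorusSite 2 L, Complex.exp (Complex.I * (θ (x, 0) : ℂ))‖ ^ 2 : ℝ) : ℂ) =
      ∑ x : TorusSite 2 L, ∑ y : TorusSite 2 L,
        Complex.exp (Complex.I * ((∑ s,
          (((Pi.single (x, (0 : ZMod M)) 1 - Pi.single (y, (0 : ZMod M)) 1 : Λ L M → ℤ) s : ℤ) : ℝ)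
            * θ s : ℝ) : ℂ)) := by
  simp_rw [sum_frq_mul]
  rw [← Complex.normSq_eq_norm_sq, ← Complex.mul_conj, map_sum, Finset.sum_mul_sum]
  refine Finset.sum_congr rfl fun x _ => Finset.sum_congr rfl fun y _ => ?_
  rw [← Complex.exp_conj, ← Complex.exp_add]
  congr 1
  simp only [map_mul, Complex.conj_I, Complex.conj_ofReal]
  push_cast
  ring

/-- integrability of a character on the (finite) cube measure. -/
theorem integrable_cexp_phase (L M : ℕ) [NeZero L] [NeZero M] (w : Λ L M → ℤ) :
    Integrable (fun θ : Λ L M → ℝ => Complex.exp (Complex.I * ((∑ s, (w s : ℝ) * θ s : ℝ) : ℂ)))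
      (volume.restrict (cube L M)) := by
  rw [restrict_cube_eq_pi]
  refine (integrable_const (1 : ℝ)).mono' ?_ (ae_of_all _ fun θ => ?_)
  · exact (Continuous.aestronglyMeasurable (by fun_prop))
  · rw [mul_comm, Complex.norm_exp_ofReal_mul_I]

/-- The free slice-order numerator: `∫_cube |Σ_x e^{iθ(x,0)}|²/L⁴ · e^{-A} = |𝕋_L|·(2π)^{|Λ|}/L⁴` at `c = 0`. -/
theorem sliceNumerator_zero_table (K : ℝ) (L M : ℕ) [NeZero L] [NeZero M] :
    ∫ θ, (((‖∑ x : TorusSite 2 L, Complex.exp (Complex.I * (θ (x, 0) : ℂ))‖ ^ 2 / (L : ℝ) ^ 4 : ℝ)) : ℂ) *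
        Complex.exp (-(action K (0 : Table 2) L M θ)) ∂(volume.restrict (cube L M)) =
      (Fintype.card (TorusSite 2 L) : ℂ) * ((2 * Real.pi : ℝ) : ℂ) ^ Fintype.card (Λ L M) / (L : ℂ) ^ 4 := by
  have hint : ∀ θ : Λ L M → ℝ,
      (((‖∑ x : TorusSite 2 L, Complex.exp (Complex.I * (θ (x, 0) : ℂ))‖ ^ 2 / (L : ℝ) ^ 4 : ℝ)) : ℂ) *
          Complex.exp (-(action K (0 : Table 2) L M θ)) =
        (∑ x : TorusSite 2 L, ∑ y : TorusSite 2 L,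
          Complex.exp (Complex.I * ((∑ s,
            (((Pi.single (x, (0 : ZMod M)) 1 - Pi.single (y, (0 : ZMod M)) 1 : Λ L M → ℤ) s : ℤ) : ℝ)
              * θ s : ℝ) : ℂ))) / (L : ℂ) ^ 4 := by
    intro θ
    rw [action_zero_table, neg_zero, Complex.exp_zero, mul_one, Complex.ofReal_div, normSq_sliceSum_eq]
    push_cast
    rfl
  simp_rw [hint]
  rw [integral_div, integral_finsetSum _ (fun x _ => ?_)]
  · rw [Finset.sum_congr rfl fun x _ => integral_finsetSum _ (fun y _ => ?_)]
    · simp_rw [integral_cube_cexp_phase, frq_eq_zero_iff]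
      simp [Finset.sum_ite_eq]
    · exact integrable_cexp_phase L M _
  · exact integrable_finsetSum _ fun y _ => integrable_cexp_phase L M _

/-- The free slice order is exactly `1/L²` (and the free `Z` is non-zero). -/
theorem sliceOrder_zero_table (K : ℝ) (L M : ℕ) [NeZero L] [NeZero M] :
    partZ K (0 : Table 2) L M ≠ 0 ∧
    ((∫ θ, (((‖∑ x : TorusSite 2 L, Complex.exp (Complex.I * (θ (x, 0) : ℂ))‖ ^ 2 / (L : ℝ) ^ 4 : ℝ)) : ℂ) *
        Complex.exp (-(action K (0 : Table 2) L M θ)) ∂(volume.restrict (cube L M))) /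
        partZ K (0 : Table 2) L M).re = 1 / (L : ℝ) ^ 2 := by
  have hπ : ((2 * Real.pi : ℝ) : ℂ) ^ Fintype.card (Λ L M) ≠ 0 :=
    pow_ne_zero _ (by exact_mod_cast (by positivity : (2 * Real.pi : ℝ) ≠ 0))
  have hLc : (L : ℂ) ≠ 0 := by exact_mod_cast (NeZero.ne L)
  refine ⟨by rw [partZ_zero_table]; exact hπ, ?_⟩
  have card_torusSite_two : Fintype.card (TorusSite 2 L) = L ^ 2 := by simp [TorusSite, ZMod.card]
  rw [sliceNumerator_zero_table, partZ_zero_table, card_torusSite_two]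
  have : ((L ^ 2 : ℕ) : ℂ) * ((2 * Real.pi : ℝ) : ℂ) ^ Fintype.card (Λ L M) / (L : ℂ) ^ 4 /
      ((2 * Real.pi : ℝ) : ℂ) ^ Fintype.card (Λ L M) = ((1 / (L : ℝ) ^ 2 : ℝ) : ℂ) := by
    push_cast
    field_simp
  rw [this, Complex.ofReal_re]

/-! ### (C) is load-bearing -/

/-- **`BirComplexStableXYR` without coercivity is false.**  The statement below is the crux
`Theses.BalabanIR.BirComplexStableXYR` verbatim with the single hypothesis
`(∀ φ, c₀ * ∑ w, ∑ w', (1 - Real.cos (φ w - φ w')) ≤ (F φ).re) →` (coercivity (C)) deleted; it fails at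
`r = 2`, `B = 0`, `c₀ = 1` for the free table `c = 0`, whose slice order is `1/L² ≤ 1/4` at the even side
`L = M = 2(L₀+1)` while `Z = (2π)^{L²M} ≠ 0` — i.e. any proof of the crux must use (C), the only hypothesis
through which `K ≥ K₀` acts. [folklore] -/
theorem birComplexStableXYR_false_without_coercivity :
    ¬ (∀ (r : ℕ) (B c₀ : ℝ), 2 ≤ r → 0 < c₀ → ∃ K₀ : ℝ, ∃ L₀ : ℕ, ∀ K : ℝ, K₀ ≤ K → ∀ c : ((Fin r × Fin r × Fin r) → ℤ) →₀ ℂ, (∀ n ∈ c.support, ∑ w, n w = 0) → c.sum (fun _ a => a) = 0 → c.sum (fun n a => ‖a‖ * Real.exp (∑ w, |(n w : ℝ)|)) ≤ B → (∀ n : (Fin r × Fin r × Fin r) → ℤ, c (fun w => n (w.1, w.2.1, Fin.rev w.2.2)) = (starRingEnd ℂ) (c (-n))) → (∀ n : (Fin r × Fin r × Fin r) → ℤ, c (fun w => n (Fin.rev w.1, Fin.rev w.2.1, w.2.2)) = c n) → ∀ (L M : ℕ) [NeZero L] [NeZero M], L₀ ≤ L → L ≤ M → Even L → Even M → let sh :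 (Literature.Probability.LatticeModels.TorusSite 2 L × ZMod M) → (Fin r × Fin r × Fin r) → (Literature.Probability.LatticeModels.TorusSite 2 L × ZMod M) := fun s w => (s.1 + ![((w.1 : ℕ) : ZMod L), ((w.2.1 : ℕ) : ZMod L)], s.2 + ((w.2.2 : ℕ) : ZMod M)); let F : ((Fin r × Fin r × Fin r) → ℝ) → ℂ := fun (φ : (Fin r × Fin r × Fin r) → ℝ) => c.sum (fun n a => a * Complex.exp (Complex.I * ((∑ w, (n w : ℝ) * φ w : ℝ) : ℂ))); let A : ((Literature.Probability.LatticeModels.TorusSite 2 L × ZMod M) → ℝ) → ℂ := fun θ => (K : ℂ) * ∑ s : (Literature.Probability.LatticeModels.TorusSite 2 L × ZMod M), F (fun w => θ (sh s w)); let cube : Set ((Literature.Probability.LatticeModels.TorusSite 2 L × ZMod M) → ℝ) := Set.pi Set.univ (fun _ => Set.Icc (0:ℝ) (2 * Real.pi)); let Z : ℂ := MeasureTheory.integral (MeasureTheory.volume.restrict cube) (fun θ => Complex.exp (-(A θ))); let O : ((Literature.Probability.LatticeModels.TorusSite 2 L × ZMod M) → ℝ) → ℝ := fun θ => ‖∑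 x : Literature.Probability.LatticeModels.TorusSite 2 L, Complex.exp (Complex.I * (θ (x, 0) : ℂ))‖ ^ 2 / (L : ℝ) ^ 4; Z ≠ 0 ∧ (1/2 : ℝ) ≤ ((MeasureTheory.integral (MeasureTheory.volume.restrict cube) (fun θ => (O θ : ℂ) * Complex.exp (-(A θ)))) / Z).re) := by
  intro h
  obtain ⟨K₀, L₀, hK⟩ := h 2 0 1 le_rfl one_pos
  -- even side `L = 2 (L₀ + 1) ≥ max L₀ 2`, `M = L`
  set L : ℕ := 2 * (L₀ + 1) with hLdef
  have hL2 : 2 ≤ L := by omega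
  have hL0 : L₀ ≤ L := by omega
  have hLe : Even L := ⟨L₀ + 1, by omega⟩
  haveI : NeZero L := ⟨by omega⟩
  -- the free table is in the mutated class
  have hU1 : ∀ n ∈ (0 : Table 2).support, ∑ w, n w = 0 := fun n hn => by simp at hn
  have hN : (0 : Table 2).sum (fun _ a => a) = 0 := by simp
  have hA : (0 : Table 2).sum (fun n a => ‖a‖ * Real.exp (∑ w, |(n w : ℝ)|)) ≤ 0 := by simp
  have hR : ∀ n : Freq 2, (0 : Table 2) (fun w => n (w.1, w.2.1, Fin.rev w.2.2)) =
      (starRingEnd ℂ) ((0 : Table 2) (-n)) := fun n => by simp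
  have hP : ∀ n : Freq 2, (0 : Table 2) (fun w => n (Fin.rev w.1, Fin.rev w.2.1, w.2.2)) =
      (0 : Table 2) n := fun n => by simp
  -- the crux's conclusion for it, in named form
  have key : partZ K₀ (0 : Table 2) L L ≠ 0 ∧ (1/2 : ℝ) ≤
      ((∫ θ, (((‖∑ x : TorusSite 2 L, Complex.exp (Complex.I * (θ (x, 0) : ℂ))‖ ^ 2 / (L : ℝ) ^ 4 : ℝ)) : ℂ) *
        Complex.exp (-(action K₀ (0 : Table 2) L L θ)) ∂(volume.restrict (cube L L))) /
        partZ K₀ (0 : Table 2) L L).re := by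
    have raw := hK K₀ le_rfl 0 hU1 hN hA hR hP L L hL0 le_rfl hLe hLe
    dsimp only at raw
    dsimp only [partZ, action, genF, sh, cube]
    exact raw
  obtain ⟨-, hre⟩ := key
  rw [(sliceOrder_zero_table K₀ L L).2] at hre
  have hL' : (2:ℝ) ≤ L := by exact_mod_cast hL2
  have : (1:ℝ) / (L:ℝ) ^ 2 ≤ 1 / 4 := by
    rw [div_le_div_iff₀ (by positivity) (by norm_num)]
    nlinarith
  linarith

end Summit.HubbardSuperconductivity.HubbardSuperconductivity.Theorems.BirComplexStableXYR.Negative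

end
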